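import Literature.AlgebraicGeometry.Motives.SeesawRelativeChartRepr
import Literature.AlgebraicGeometry.Motives.SeesawChartDualKernelRepr
import HarnessLib

/-!
# RELATIVE EDITION (ring base `R`) — The dual kernel representation on a seesaw chart from the `H⁰` one for the dual module:
# `DualKernelRepr X 𝓕 U h𝓕` from `H0KernelRepr X (𝓕^∨) U` (Mumford AV §5, §10)

RELATIVE EDITION of ★ `Motives/SeesawChartDualKernelRepr` (cell `hodgecm-mathlib`, F-DAG hand (h8-E) «engine of the relative seesaw»,
file E10; author B-p08 (g12); port map `B-provers/B-p08/g11/PORTMAP-h8-RelativeSeesaw.B-p08g11.md`): the ★ file is typed over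
`SchemeOver ℂ` and uses the field nowhere (pure chart algebra: ★ `Modules.dualSectionsEquiv(_naturality)`, base-free, IMPORTED);
decl for decl the twin of ★ with `ℂ ↦ R` against g11՚s ★ relative chart vocabulary `SeesawRelative.H0 / DualSec / DualSecMap / H0map /
FBIso` (`Motives/SeesawRelativeChartSections`) and the relative sockets `SeesawRelative.H0KernelRepr / DualKernelRepr`
(`Motives/SeesawRelativeChartRepr`), namespace `Literature.AlgebraicGeometry.Motives.SeesawRelative`: §1 `dualSecEquivH0`,
`dualSecEquivH0_apply`, `whiskerLeft_specTestMap_left_comp`, `fbIso_eq`, `dualSecMap_eq`, `h0map_eq`, `dualSecMap_dualSectionsEquiv`,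
`dualSecEquivH0_dualSecMap`; §2 **`dualKernelRepr_of_h0KernelRepr_dual`**.  Everything is proved; no named facts, no `sorry`; one
definition (`dualSecEquivH0`, the `B`-linear repackaging of an inverse linear equivalence, as ★).  HC_CM is proved only modulo the 7
printed citations until rung 0 closes; this file asserts nothing about HC.  Original module docstring (read `ℂ` as `R`):

`Motives/SeesawChartRepr` states two properties of a quasi-coherent module `𝓕` on `X ×_ℂ W` over an affine chart
`U ⊆ W` (`A = Γ(W, U)`): a two-term complex of finite projective `A`-modules computes, naturally in the
`A`-algebra `B`, `H0KernelRepr X 𝓕 U` (the sections `H⁰(X_B, 𝓕_B)`) and `DualKernelRepr X 𝓕 U h𝓕` (the dual sections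
`Hom(𝓕_B|_⊤, 𝒪|_⊤)`, for `𝓕` of rank one).  **The second follows from the first applied to the dual module
`𝓕^∨ = Modules.dual 𝓕`** — with no geometry: ★ `Modules/DualSectionsEquiv.dualSectionsEquiv f h𝓕 :
Γ(f^*(𝓕^∨), ⊤) ≃ₗ ((f^*𝓕)|_⊤ ⟶ 𝒪|_⊤)` (Hartshorne II Ex. 5.1 (b), (d)) identifies `H0 X (Modules.dual 𝓕) U B` with
`DualSec X 𝓕 U B`, and ★ `dualSectionsEquiv_naturality` is literally the statement that this identification carries
`H0map X (Modules.dual 𝓕) U φ` to `DualSecMap X 𝓕 U h𝓕 φ`.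

## References
* D. Mumford, *Abelian Varieties*, TIFR Studies in Mathematics 5 (1970), §5 (pp. 46–47), §10 (p. 89). [MumfordAV1970]
* R. Hartshorne, *Algebraic Geometry*, GTM 52 (1977), II Ex. 5.1 (b), (d). [Hartshorne1977]
-/

set_option autoImplicit false

noncomputable section

-- `TopCat.Presheaf`/`Scheme.Modules` are not reducible (as in ★ `Modules/DualSectionsEquiv`).
set_option backward.isDefEq.respectTransparency false

open CategoryTheory CategoryTheory.Limits AlgebraicGeometry MonoidalCategory CartesianMonoidalCategory
open scoped TensorProduct

namespace Literature.AlgebraicGeometry.Motives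

namespace SeesawRelative

open Literature.AlgebraicGeometry.Modules

variable {R : Type} [CommRing R] (X : SchemeOver R) {W : SchemeOver R} (𝓕 : (X ⊗ W).left.Modules) (U : W.left.affineOpens)

/-! ## §1 `DualSec X 𝓕 U B ≃ₗ[B] SeesawRelative.H0 X (𝓕^∨) U B` (brick (C)) and its naturality in `B` -/

/-- **`Hom(𝓕_B|_⊤, 𝒪|_⊤) ≃ₗ[B] H⁰(X_B, (𝓕^∨)_B)`**: the inverse of ★ `dualSectionsEquiv` for
`f = 1_X × u_B`, `B`-linear because both `B`-module structures are `Module.compHom` through `toTopRing`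
(non-Prop plumbing). [cite: Hartshorne1977, II Ex. 5.1 (b) and (d)] -/
def dualSecEquivH0 (h𝓕 : HasRank 𝓕 1) (B : Type) [CommRing B] [Algebra Γ(W.left, U) B] :
    SeesawRelative.DualSec X 𝓕 U B ≃ₗ[B] SeesawRelative.H0 X (Modules.dual 𝓕) U B :=
  @AddEquiv.toLinearEquiv B (SeesawRelative.DualSec X 𝓕 U B) (SeesawRelative.H0 X (Modules.dual 𝓕) U B) _ _ _
    (SeesawRelative.instModuleDualSec X 𝓕 U B) (SeesawRelative.instModuleH0 X (Modules.dual 𝓕) U B)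
    ((dualSectionsEquiv (X ◁ SeesawRelative.specTestHom U B).left h𝓕).symm.toAddEquiv :
      SeesawRelative.DualSec X 𝓕 U B ≃+ SeesawRelative.H0 X (Modules.dual 𝓕) U B)
    fun b μ =>
      -- both `B`-actions are `Module.compHom SeesawRelative.toTopRing`: `b • x = SeesawRelative.toTopRing b • x` definitionally
      (dualSectionsEquiv (X ◁ SeesawRelative.specTestHom U B).left h𝓕).symm.map_smul (SeesawRelative.toTopRing X U B b) μ

/-- `dualSecEquivH0` is `(dualSectionsEquiv _ h𝓕)⁻¹` as a function. [folklore] [cite: MumfordAV1970, §5 (pp. 46–47)] -/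
theorem dualSecEquivH0_apply (h𝓕 : HasRank 𝓕 1) (B : Type) [CommRing B] [Algebra Γ(W.left, U) B]
    (μ : SeesawRelative.DualSec X 𝓕 U B) :
    SeesawRelative.dualSecEquivH0 X 𝓕 U h𝓕 B μ = (dualSectionsEquiv (X ◁ SeesawRelative.specTestHom U B).left h𝓕).symm μ := rfl

/-- `(1 × Spec φ) ≫ (1 × u_B) = 1 × u_C`. [folklore] [cite: MumfordAV1970, §5 (pp. 46–47)] -/
theorem whiskerLeft_specTestMap_left_comp {B C : Type} [CommRing B] [Algebra Γ(W.left, U) B] [CommRing C]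
    [Algebra Γ(W.left, U) C] (φ : B →ₐ[Γ(W.left, U)] C) :
    (X ◁ SeesawRelative.specTestMap U φ).left ≫ (X ◁ SeesawRelative.specTestHom U B).left = (X ◁ SeesawRelative.specTestHom U C).left := by
  rw [← Over.comp_left, ← MonoidalCategory.whiskerLeft_comp, specTestMap_comp]

/-- `FBIso` with the composite identity named (`rfl`, proof-irrelevant `pullbackCongr` argument). [folklore] [cite: MumfordAV1970, §5 (pp. 46–47)] -/
theorem fbIso_eq (𝓕' : (X ⊗ W).left.Modules) {B C : Type} [CommRing B] [Algebra Γ(W.left, U) B] [CommRing C]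
    [Algebra Γ(W.left, U) C] (φ : B →ₐ[Γ(W.left, U)] C) :
    SeesawRelative.FBIso X 𝓕' U φ =
      (Scheme.Modules.pullbackComp (X ◁ SeesawRelative.specTestMap U φ).left (X ◁ SeesawRelative.specTestHom U B).left).app 𝓕' ≪≫
        (Scheme.Modules.pullbackCongr (SeesawRelative.whiskerLeft_specTestMap_left_comp X U φ)).app 𝓕' :=
  rfl

/-- `DualSecMap` UNAPPLIED (`rfl` on the literal body; unapplied `rfl`s
check fast, applied ones do not). [folklore] [cite: MumfordAV1970, §5 (pp. 46–47)] -/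
theorem dualSecMap_eq (h𝓕 : HasRank 𝓕 1) {B C : Type} [CommRing B] [Algebra Γ(W.left, U) B] [CommRing C]
    [Algebra Γ(W.left, U) C] (φ : B →ₐ[Γ(W.left, U)] C) :
    SeesawRelative.DualSecMap X 𝓕 U h𝓕 φ = fun μ =>
      ((sheafHomMapLeft (SeesawRelative.FBIso X 𝓕 U φ).inv (unitModule (X ⊗ SeesawRelative.specTest U C).left)).app ⊤)
        (((pullbackDualIso (X ◁ SeesawRelative.specTestMap U φ).left
            (HasRank.isFiniteLocallyFree' (SeesawRelative.hasRank_FB X 𝓕 U h𝓕 B))).hom.app ⊤)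
          (unitSection (X ◁ SeesawRelative.specTestMap U φ).left (Modules.dual (SeesawRelative.FB X 𝓕 U B)) ⊤ μ)) :=
  rfl

/-- `H0map` UNAPPLIED (`rfl` on the literal body). [folklore] [cite: MumfordAV1970, §5 (pp. 46–47)] -/
theorem h0map_eq (𝓕' : (X ⊗ W).left.Modules) {B C : Type} [CommRing B] [Algebra Γ(W.left, U) B] [CommRing C]
    [Algebra Γ(W.left, U) C] (φ : B →ₐ[Γ(W.left, U)] C) :
    SeesawRelative.H0map X 𝓕' U φ = fun s =>
      ((SeesawRelative.FBIso X 𝓕' U φ).hom.app ⊤) (unitSection (X ◁ SeesawRelative.specTestMap U φ).left (SeesawRelative.FB X 𝓕' U B) ⊤ s) :=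
  rfl

/-- The naturality square on a section `s` of `(𝓕^∨)_B`, read through `dualSectionsEquiv`
(= ★ `dualSectionsEquiv_naturality`, reversed). [cite: Hartshorne1977, II Ex. 5.1 (d)] -/
theorem dualSecMap_dualSectionsEquiv (h𝓕 : HasRank 𝓕 1) {B C : Type} [CommRing B] [Algebra Γ(W.left, U) B]
    [CommRing C] [Algebra Γ(W.left, U) C] (φ : B →ₐ[Γ(W.left, U)] C)
    (s : SeesawRelative.H0 X (Modules.dual 𝓕) U B) :
    SeesawRelative.DualSecMap X 𝓕 U h𝓕 φ (dualSectionsEquiv (X ◁ SeesawRelative.specTestHom U B).left h𝓕 s) =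
      dualSectionsEquiv (X ◁ SeesawRelative.specTestHom U C).left h𝓕 (SeesawRelative.H0map X (Modules.dual 𝓕) U φ s) := by
  have key := dualSectionsEquiv_naturality (X ◁ SeesawRelative.specTestMap U φ).left (X ◁ SeesawRelative.specTestHom U B).left h𝓕
    (SeesawRelative.whiskerLeft_specTestMap_left_comp X U φ) s
  rw [SeesawRelative.dualSecMap_eq, SeesawRelative.h0map_eq, SeesawRelative.fbIso_eq, SeesawRelative.fbIso_eq]
  beta_reduce
  exact key.symm

/-- **NATURALITY of `dualSecEquivH0`**: it carries `DualSecMap X 𝓕 U h𝓕 φ` to `H0map X (𝓕^∨) U φ` — this IS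
★ `dualSectionsEquiv_naturality` (its transport `pullbackComp ≪≫ pullbackCongr` is `FBIso X (𝓕^∨) U φ`,
its right-hand side is `DualSecMap`). [cite: Hartshorne1977, II Ex. 5.1 (d)] [cite: MumfordAV1970, §5 Cor. 2 (p. 50) and §10 (p. 89)] -/
theorem dualSecEquivH0_dualSecMap (h𝓕 : HasRank 𝓕 1) {B C : Type} [CommRing B] [Algebra Γ(W.left, U) B]
    [CommRing C] [Algebra Γ(W.left, U) C] (φ : B →ₐ[Γ(W.left, U)] C) (μ : SeesawRelative.DualSec X 𝓕 U B) :
    SeesawRelative.dualSecEquivH0 X 𝓕 U h𝓕 C (SeesawRelative.DualSecMap X 𝓕 U h𝓕 φ μ) =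
      SeesawRelative.H0map X (Modules.dual 𝓕) U φ (SeesawRelative.dualSecEquivH0 X 𝓕 U h𝓕 B μ) := by
  rw [SeesawRelative.dualSecEquivH0_apply, SeesawRelative.dualSecEquivH0_apply, LinearEquiv.symm_apply_eq]
  -- write `μ = dualSectionsEquiv _ s`
  obtain ⟨s, rfl⟩ := (dualSectionsEquiv (X ◁ SeesawRelative.specTestHom U B).left h𝓕).surjective μ
  rw [LinearEquiv.symm_apply_apply]
  exact SeesawRelative.dualSecMap_dualSectionsEquiv X 𝓕 U h𝓕 φ s

/-! ## §2 The dual socket from the `H⁰` socket of the dual module -/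

/-- **`DualKernelRepr X 𝓕 U h𝓕` follows from `H0KernelRepr X (𝓕^∨) U`**: transport the kernel representation
`θ_B : H⁰(X_B, (𝓕^∨)_B) ≃ₗ[B] ker(d ⊗ B)` along `dualSecEquivH0`; naturality is `dualSecEquivH0_dualSecMap` followed by
the naturality of `θ`. [cite: MumfordAV1970, §5 (pp. 46–47)] -/
theorem dualKernelRepr_of_h0KernelRepr_dual (h𝓕 : HasRank 𝓕 1) (h : SeesawRelative.H0KernelRepr X (Modules.dual 𝓕) U) :
    SeesawRelative.DualKernelRepr X 𝓕 U h𝓕 := by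
  obtain ⟨K0, K1, i₁, i₂, i₃, i₄, i₅, i₆, i₇, i₈, d, θ, hθ⟩ := h
  refine ⟨K0, K1, i₁, i₂, i₃, i₄, i₅, i₆, i₇, i₈, d, fun B _ _ => (SeesawRelative.dualSecEquivH0 X 𝓕 U h𝓕 B).trans (θ B), ?_⟩
  intro B C _ _ _ _ φ μ
  change ((θ C (SeesawRelative.dualSecEquivH0 X 𝓕 U h𝓕 C (SeesawRelative.DualSecMap X 𝓕 U h𝓕 φ μ)) : C ⊗[Γ(W.left, U)] K0)) =
    φ.toLinearMap.rTensor K0 ((θ B (SeesawRelative.dualSecEquivH0 X 𝓕 U h𝓕 B μ)) : B ⊗[Γ(W.left, U)] K0)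
  rw [SeesawRelative.dualSecEquivH0_dualSecMap]
  exact hθ B C φ _

end SeesawRelative

end Literature.AlgebraicGeometry.Motives

end
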